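import Summits.HodgeConjecture.HodgeConjecture.Theorems.R90S6SatakeGraphPartnerOnBasisClosed   -- ★ H1 §3 (this seat): `xiHCoeff`, `satakeGraphPartnerAlgHom_doubleCosetOperator_torusGen_pow`
import Summits.HodgeConjecture.HodgeConjecture.Theorems.R90S6EllipticOrbitalDisplacementU2       -- ★ A1-H (p01): `orbitalIntegral_doubleCosetShell_eq_mul_ncard_displaced_two`, `finite_quotient_shell_of_finite_displaced_two`
import Summits.HodgeConjecture.HodgeConjecture.Theorems.R90S6EllipticOrbitalDisplacementCount    -- ★ A1 (p01): `conj_mem_doubleCoset_iff`, `setOf_out_conj_mem_doubleCoset_eq`, `isOpen_doubleCoset`; brings ★ (J1)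
import HarnessLib

/-!
# R90 · S6 — CARD H2 (rows E1.3.5.2.5 ∕ E1.3.7.1–2): THE H-SIDE ELLIPTIC VALUE OF `ξ̂_H(φ_m)` AS AN EXPLICIT `ℂ`-COMBINATION OF DISPLACEMENT COUNTS
# (`Theorems/R90S6HSideEllipticValue.lean`)

Cell `hodgecm-mathlib`, crux H413 (`stmt-HodgeConjecture-24833`), route of record `HCCMUnconditional`; programme R90-TF, section S6 (base `R90-C14`), seat
R90-C14-p03 (g2); card H2 (dealer R90-C14-plan (g2), R90 bus 2026-09-05T01:13:19Z; census + heads 01:20Z).  Helper lane `--supports stmt-HodgeConjecture-24833 --as helper`;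
THEOREMS ONLY (no definition, no instance, no notation, no named fact, no `sorry`); imports ★ H1 §3 `R90S6SatakeGraphPartnerOnBasisClosed` + ★ A1-H
`R90S6EllipticOrbitalDisplacementU2` + ★ A1 `R90S6EllipticOrbitalDisplacementCount` (brings ★ (J1) `R90S6OrbitalIndicatorShellCount`) + HarnessLib.

THE JUNCTION (§1, generic — the letter the tree lacked).  The bi-`K`-invariant FUNCTION of `T ∈ ℋ(G, K) = End_G(ℂ[G ⧸ K])` is `g ↦ (T [K])(gK)`, spelled
`fun g => (heckeAlgebra.toVector K T).coeff (g : G ⧸ K)` (★ `R90S6HeckeCoeffOrbit`; it IS S6-D's `heckeToFun K T` by `rfl`).  On the basis: the function of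
`T_{KsK} = doubleCosetOperator K s` is `1_{KsK}` (★ `toVector_doubleCosetOperator`, ★ `coeff_doubleCosetIndicator`) — `coeff_toVector_doubleCosetOperator_eq_indicator`;
it is `ℂ`-linear in `T` — `coeff_toVector_sum_smul`; the orbital integral ★ `orbitalIntegral` is linear in the test function GIVEN Bochner integrability of each
summand (★ `orbitalIntegral_add`) — `orbitalIntegral_finset_sum_smul`; the `ℂ`-valued indicator integral is the real one — `orbitalIntegral_indicator_complex_eq_ofReal`;
and at a COMPACT centraliser, `K` open of finite Haar measure and a finite shell, the orbital integrand of `1_S` IS integrable (★ (J1)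
`lintegral_descConj_indicator_quotientMeasure_eq_mul_encard_shell`) — `integrable_descConj_indicator_shell`.  Assembly (any group):
**`O_γ(fun of Σ_i c_i T_{K g_i K}) = ν(K) · Σ_i c_i · #{q ∈ G ⧸ K : q.out⁻¹ γ q.out ∈ K g_i K}`** — `orbitalIntegral_coeff_toVector_eq_mul_sum_ncard_shell`.

THE H-SIDE VALUE (§2 abstract `U(1,1)`, §3 at the inert place).  With p01's ★ A1-H (`O_γ(1_{K₀ t′ᵏ K₀}) = ν(K₀)·#{x self-dual : d(x, γx) = 2k}` on the `(q_v+1)`-regular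
tree) and ★ H1 §3 (`ξ̂_H(φ_m) = Σ_{k ≤ m} c_{m,k} φ′_k`, `c_{m,k} = xiHCoeff q_v m k`):
**`O_γ(ξ̂_H φ_m) = ν(K₀) · Σ_{k ≤ m} xiHCoeff q_v m k · #{x ∈ X₂(E_w) self-dual : d(x, γ·x) = 2k}`** for `γ ∈ U(J₀,2)(E_w)` with compact centraliser (mass-one `ρ`), finitely
many displaced self-dual vertices at each even distance `≤ 2m` — `orbitalIntegral_satakeGraphPartner_torusGen_pow`.  The `U(1)`-factor of `H_v = U(2)_w × U(1)_v` (row E1.3.7.2: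
`ℋ(U(1)(F_v), U(1)(𝒪_v)) = ℂ·1`, `U(1)` anisotropic at inert `v`) multiplies this by the scalar `ν₁(U(1)(𝒪_v))`; no product-group orbital integral is typed here.
HONEST LABEL: measure ∕ Hecke bookkeeping over ★ carriers; the topological, Borel and Haar structures on `U(J₀,2)(E_w)` and the self-dual transitivity `hA` are BINDERS
(as in ★ A1-H); proves no printed global statement, discharges no citation; count-neutral helper until E1.3.5.2.5∕.6 consume it.
HC_CM is proved only modulo the 7 printed citations (2 remaining named inputs: hLiu418 = stmt-HodgeConjecture-24832, h413 = stmt-HodgeConjecture-24833) until rung 0 closes; REL ≠ ★ ≠ BUILT.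

## References
* [Rogawski1990] J. D. Rogawski, *Automorphic Representations of Unitary Groups in Three Variables*, Ann. of Math. Stud. 123 (1990): §4.9 pp. 54–56 (`Φ(γ, f)`,
  `ξ̂_H`, Prop. 4.9.1 (b)), §4.11 pp. 59–60.
* [LabesseLanglands1979] J.-P. Labesse, R. P. Langlands, *L-indistinguishability for SL(2)*, Canad. J. Math. 31 (1979): §§2–3.
* [CartierCorvallis1979] P. Cartier, *Representations of 𝔭-adic groups: a survey*, PSPM 33.1 (1979): §I.3–I.4, §IV (4.2)–(4.4).
* [Laumon1995] G. Laumon, *Cohomology of Drinfeld Modular Varieties*, Part I (1996): Lemma (5.3.2) p. 136.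
-/

set_option autoImplicit false
-- the mandated namespace repeats the single-problem summit's segment (`HodgeConjecture.HodgeConjecture`)
set_option linter.dupNamespace false

noncomputable section

open MeasureTheory Measure Topology Set Function
open scoped ENNReal NNReal Pointwise ValuativeRel Matrix MatrixGroups
open MulAction SimpleGraph Matrix ValuativeRel
open Literature.MeasureTheory.Group Literature.NumberTheory.Automorphic Literature.NumberTheory.Automorphic.heckeAlgebra
open Literature.NumberTheory.Automorphic.HermitianLatticeTree
open Literature.Combinatorics.SimpleGraph

namespace Summit.HodgeConjecture.HodgeConjecture.R90.S6

/-! ## §1 The junction: the function of a Hecke-algebra element, and the orbital integral of a finite combination of shell indicators -/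

section HeckeFun

variable {k G : Type*} [CommRing k] [Group G] (K : Subgroup G)

/-- **The function of `T_{KsK}` is `1_{KsK}`**: `(T_{KsK} [K])(gK) = 1_{KsK}(g)` (★ `toVector_doubleCosetOperator`, ★ `coeff_doubleCosetIndicator`, and `g ∈ KsK ↔ gK ∈ K·sK`
★ `mem_doubleCoset_iff_mk_mem_orbit`). [cite: CartierCorvallis1979, §I.3–I.4] -/
theorem coeff_toVector_doubleCosetOperator_eq_indicator [IsHeckeTriple (⊤ : Submonoid G) K K] (s g : G) :
    (toVector K (doubleCosetOperator (k := k) K s)).coeff (g : G ⧸ K) = (DoubleCoset.doubleCoset s (K : Set G) K).indicator (1 : G → k) g := by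
  classical
  rw [toVector_doubleCosetOperator, coeff_doubleCosetIndicator]
  by_cases h : g ∈ DoubleCoset.doubleCoset s (K : Set G) K
  · rw [if_pos ((mem_doubleCoset_iff_mk_mem_orbit s g).1 h), Set.indicator_of_mem h, Pi.one_apply]
  · rw [if_neg (fun h' => h ((mem_doubleCoset_iff_mk_mem_orbit s g).2 h')), Set.indicator_of_notMem h]

/-- **The function of `T` is `k`-linear in `T`**: the `xK`-coefficient of `(Σ_i c_i T_i) [K]` is `Σ_i c_i · (T_i [K])(xK)` (★ `toVector` is linear). [cite: CartierCorvallis1979, §I.3–I.4] -/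
theorem coeff_toVector_sum_smul {ι : Type*} (S : Finset ι) (c : ι → k) (T : ι → heckeAlgebra k G K) (x : G ⧸ K) :
    (toVector K (∑ i ∈ S, c i • T i)).coeff x = ∑ i ∈ S, c i * (toVector K (T i)).coeff x := by
  simp only [_root_.map_sum, _root_.map_smul, MonoidAlgebra.coeff_sum, MonoidAlgebra.coeff_smul, Finsupp.finsetSum_apply, Finsupp.smul_apply,
    smul_eq_mul]

end HeckeFun

section OrbitalLinear

variable {G : Type*} [Group G] (γ : G) [MeasurableSpace (G ⧸ Subgroup.centralizer ({γ} : Set G))]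
  (m : Measure (G ⧸ Subgroup.centralizer ({γ} : Set G)))

/-- **Linearity of the orbital integral on a finite combination**: `O_γ(Σ_i c_i f_i) = Σ_i c_i O_γ(f_i)` when every orbital integrand `y ↦ f_i(y γ y⁻¹)` is Bochner
integrable (★ `orbitalIntegral_add`, ★ `orbitalIntegral_smul`). [cite: Rogawski1990, §4.9 p. 54] -/
theorem orbitalIntegral_finset_sum_smul {ι : Type*} (S : Finset ι) (c : ι → ℂ) (f : ι → G → ℂ)
    (hf : ∀ i ∈ S, Integrable (descConj γ (Subgroup.centralizer ({γ} : Set G)) (fun _ hg => Subgroup.mem_centralizer_singleton_iff.1 hg) (f i)) m) :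
    orbitalIntegral γ (∑ i ∈ S, c i • f i) m = ∑ i ∈ S, c i * orbitalIntegral γ (f i) m := by
  classical
  induction S using Finset.induction_on with
  | empty => rw [Finset.sum_empty, Finset.sum_empty]; exact orbitalIntegral_zero_fun γ m
  | insert a S ha ih =>
    have hfS : ∀ i ∈ S, Integrable (descConj γ (Subgroup.centralizer ({γ} : Set G))
        (fun _ hg => Subgroup.mem_centralizer_singleton_iff.1 hg) (f i)) m := fun i hi => hf i (Finset.mem_insert_of_mem hi)
    -- the orbital integrand of a combination is the combination of the orbital integrands
    have e1 : descConj γ (Subgroup.centralizer ({γ} : Set G)) (fun _ hg => Subgroup.mem_centralizer_singleton_iff.1 hg) (c a • f a) =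
        c a • descConj γ (Subgroup.centralizer ({γ} : Set G)) (fun _ hg => Subgroup.mem_centralizer_singleton_iff.1 hg) (f a) := by
      funext y
      induction y using QuotientGroup.induction_on with
      | H g => rfl
    have e2 : descConj γ (Subgroup.centralizer ({γ} : Set G)) (fun _ hg => Subgroup.mem_centralizer_singleton_iff.1 hg) (∑ i ∈ S, c i • f i) =
        ∑ i ∈ S, c i • descConj γ (Subgroup.centralizer ({γ} : Set G)) (fun _ hg => Subgroup.mem_centralizer_singleton_iff.1 hg) (f i) := by
      funext y
      induction y using QuotientGroup.induction_on with
      | H g => simp only [descConj_mk, Finset.sum_apply, Pi.smul_apply]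
    have hIa : Integrable (descConj γ (Subgroup.centralizer ({γ} : Set G)) (fun _ hg => Subgroup.mem_centralizer_singleton_iff.1 hg) (c a • f a)) m := by
      rw [e1]; exact (hf a (Finset.mem_insert_self a S)).smul (c a)
    have hIS : Integrable (descConj γ (Subgroup.centralizer ({γ} : Set G)) (fun _ hg => Subgroup.mem_centralizer_singleton_iff.1 hg) (∑ i ∈ S, c i • f i)) m := by
      rw [e2]; exact integrable_finsetSum' S (fun i hi => (hfS i hi).smul (c i))
    rw [Finset.sum_insert ha, Finset.sum_insert ha, orbitalIntegral_add γ m hIa hIS, orbitalIntegral_smul, smul_eq_mul, ih hfS]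

/-- **The `ℂ`-valued orbital integral of an indicator is the real one**: `O_γ(1_S : G → ℂ) = ↑(O_γ(1_S : G → ℝ))` (★ `integral_complex_ofReal`). [cite: Rogawski1990, §4.9 p. 54] -/
theorem orbitalIntegral_indicator_complex_eq_ofReal (S : Set G) :
    orbitalIntegral γ (S.indicator (1 : G → ℂ)) m = ((orbitalIntegral γ (S.indicator (1 : G → ℝ)) m : ℝ) : ℂ) := by
  rw [orbitalIntegral_eq_integral_descConj, orbitalIntegral_eq_integral_descConj, ← integral_complex_ofReal]
  refine integral_congr_ae (Filter.Eventually.of_forall fun y => ?_)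
  induction y using QuotientGroup.induction_on with
  | H g =>
    simp only [descConj_mk]
    by_cases hg : g * γ * g⁻¹ ∈ S
    · rw [Set.indicator_of_mem hg, Set.indicator_of_mem hg, Pi.one_apply, Pi.one_apply, Complex.ofReal_one]
    · rw [Set.indicator_of_notMem hg, Set.indicator_of_notMem hg, Complex.ofReal_zero]

end OrbitalLinear

section Shell

variable {G : Type*} [Group G] [TopologicalSpace G] [IsTopologicalGroup G] [LocallyCompactSpace G]
  [SecondCountableTopology G] [T2Space G] [MeasurableSpace G] [BorelSpace G]
  (γ : G) (K : Subgroup G)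
  [MeasurableSpace (G ⧸ Subgroup.centralizer ({γ} : Set G))]
  [BorelSpace (G ⧸ Subgroup.centralizer ({γ} : Set G))]
  [hC : IsClosed ((Subgroup.centralizer ({γ} : Set G) : Subgroup G) : Set G)]
  (t : Measure (Subgroup.centralizer ({γ} : Set G))) [t.IsMulLeftInvariant]
  [IsFiniteMeasureOnCompacts t] [t.IsOpenPosMeasure] [t.IsInvInvariant] [SFinite t]
  (ν : Measure G) [IsHaarMeasure ν] [ν.IsMulRightInvariant]
  [CompactSpace (Subgroup.centralizer ({γ} : Set G))]

/-- **The orbital integrand of a shell indicator is Bochner integrable** (compact centraliser of `t`-mass one, `S` open and `K`-conjugation invariant, `K` open with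
`ν(K) < ∞`, finitely many cosets `qK` with `q.out⁻¹ γ q.out ∈ S`): its `[0, ∞]`-integral is `ν(K) · #shell < ∞` by ★ (J1)
`lintegral_descConj_indicator_quotientMeasure_eq_mul_encard_shell`. [cite: Rogawski1990, §4.9 p. 54] [cite: Laumon1995, Lemma (5.3.2) p. 136] -/
theorem integrable_descConj_indicator_shell {S : Set G} (hS : IsOpen S) (hSK : ∀ k : G, k ∈ K → ∀ g : G, k * g * k⁻¹ ∈ S ↔ g ∈ S)
    (hK : IsOpen (K : Set G)) (ht : t Set.univ = 1) (hνK : ν K ≠ ∞) (hfin : {q : G ⧸ K | q.out⁻¹ * γ * q.out ∈ S}.Finite) :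
    Integrable (descConj γ (Subgroup.centralizer ({γ} : Set G)) (fun _ hg => Subgroup.mem_centralizer_singleton_iff.1 hg) (S.indicator (1 : G → ℂ)))
      (quotientMeasure (Subgroup.centralizer ({γ} : Set G)) t hC ν) := by
  refine ⟨(measurable_descConj γ _ _ (measurable_one.indicator hS.measurableSet)).aestronglyMeasurable, ?_⟩
  -- `∫⁻ ‖1_S(y γ y⁻¹)‖ₑ = ∫⁻ 1_S(y γ y⁻¹) = ν(K) · #shell < ∞`
  have e : (fun y => ‖descConj γ (Subgroup.centralizer ({γ} : Set G)) (fun _ hg => Subgroup.mem_centralizer_singleton_iff.1 hg)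
      (S.indicator (1 : G → ℂ)) y‖ₑ) =
      descConj γ (Subgroup.centralizer ({γ} : Set G)) (fun _ hg => Subgroup.mem_centralizer_singleton_iff.1 hg) (S.indicator (1 : G → ℝ≥0∞)) := by
    funext y
    induction y using QuotientGroup.induction_on with
    | H g =>
      simp only [descConj_mk]
      by_cases hg : g * γ * g⁻¹ ∈ S
      · rw [Set.indicator_of_mem hg, Set.indicator_of_mem hg, Pi.one_apply, Pi.one_apply, enorm_one]
      · rw [Set.indicator_of_notMem hg, Set.indicator_of_notMem hg, enorm_zero]
  unfold HasFiniteIntegral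
  rw [e, lintegral_descConj_indicator_quotientMeasure_eq_mul_encard_shell γ K t ν hS hSK hK ht, hfin.encard_eq_coe_toFinset_card, ENat.toENNReal_coe]
  exact ENNReal.mul_lt_top hνK.lt_top (ENNReal.natCast_lt_top _)

/-- **THE JUNCTION, assembled (any locally compact group)**: if `T = Σ_{i ∈ S} c_i T_{K g_i K}` in `ℋ(G, K)` (`K` open, `ν(K) < ∞`; `γ` with compact centraliser of
`t`-mass one; each shell `{qK : q.out⁻¹ γ q.out ∈ K g_i K}` finite), then the orbital integral of the FUNCTION of `T` is
`O_γ^{ν∕t}(g ↦ (T[K])(gK)) = ν(K) · Σ_i c_i · #{q ∈ G ⧸ K : q.out⁻¹ γ q.out ∈ K g_i K}` — Rogawski's `Φ(γ, f) = Σ_x vol(…)⁻¹ f(x⁻¹γx)` for `f` a finite combination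
of characteristic functions of double cosets (★ (J1) per shell). [cite: Rogawski1990, §4.9 pp. 54–55] [cite: Laumon1995, Lemma (5.3.2) p. 136] -/
theorem orbitalIntegral_coeff_toVector_eq_mul_sum_ncard_shell {ι : Type*} [IsHeckeTriple (⊤ : Submonoid G) K K]
    (T : heckeAlgebra ℂ G K) (S : Finset ι) (c : ι → ℂ) (g : ι → G) (hT : T = ∑ i ∈ S, c i • doubleCosetOperator K (g i))
    (hK : IsOpen (K : Set G)) (ht : t Set.univ = 1) (hνK : ν K ≠ ∞)
    (hfin : ∀ i ∈ S, {q : G ⧸ K | q.out⁻¹ * γ * q.out ∈ DoubleCoset.doubleCoset (g i) (K : Set G) K}.Finite) :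
    orbitalIntegral γ (fun x : G => (toVector K T).coeff (x : G ⧸ K)) (quotientMeasure (Subgroup.centralizer ({γ} : Set G)) t hC ν) =
      (ν K).toReal * ∑ i ∈ S, c i * ({q : G ⧸ K | q.out⁻¹ * γ * q.out ∈ DoubleCoset.doubleCoset (g i) (K : Set G) K}.ncard : ℂ) := by
  -- the function of `T` is `Σ_i c_i 1_{K g_i K}`
  have hfun : (fun x : G => (toVector K T).coeff (x : G ⧸ K)) = ∑ i ∈ S, c i • (DoubleCoset.doubleCoset (g i) (K : Set G) K).indicator (1 : G → ℂ) := by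
    funext x
    rw [hT, coeff_toVector_sum_smul, Finset.sum_apply]
    refine Finset.sum_congr rfl fun i _ => ?_
    rw [Pi.smul_apply, smul_eq_mul, coeff_toVector_doubleCosetOperator_eq_indicator]
  have hint : ∀ i ∈ S, Integrable (descConj γ (Subgroup.centralizer ({γ} : Set G)) (fun _ hg => Subgroup.mem_centralizer_singleton_iff.1 hg)
      ((DoubleCoset.doubleCoset (g i) (K : Set G) K).indicator (1 : G → ℂ))) (quotientMeasure (Subgroup.centralizer ({γ} : Set G)) t hC ν) :=
    fun i hi => integrable_descConj_indicator_shell γ K t ν (isOpen_doubleCoset K (g i) hK) (conj_mem_doubleCoset_iff K (g i)) hK ht hνK (hfin i hi)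
  rw [hfun, orbitalIntegral_finset_sum_smul γ _ S c _ hint, Finset.mul_sum]
  refine Finset.sum_congr rfl fun i hi => ?_
  rw [orbitalIntegral_indicator_complex_eq_ofReal,
    orbitalIntegral_indicator_quotientMeasure_eq_mul_ncard_shell γ K t ν (isOpen_doubleCoset K (g i) hK) (conj_mem_doubleCoset_iff K (g i)) hK ht (hfin i hi)]
  push_cast
  ring

end Shell

/-! ## §2 `U(1,1)`: the orbital integral of the function of `Σ_k c_k φ′_k` as a combination of displacement counts on the `(q+1)`-regular tree -/

section Two

variable {K : Type} [Field K] [Valued K (WithZero (Multiplicative ℤ))] [ValuativeRel K]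
  [(Valued.v : Valuation K (WithZero (Multiplicative ℤ))).Compatible] {σ : K →+* K} {ϖ : K}
  (hd : HermitianLattice.UnramifiedLocalConjDatum σ ϖ)
  (t : unitaryGroupOfForm σ ((StdForm.antidiagonal 2).over K))
  (ht : (t : GL (Fin 2) K) = zpowDiagGL (CartanUnique.uniformizer_ne_zero hd.vϖ) ![(1 : ℤ), -1])
  (hA : ∀ M : Submodule 𝒪[K] (Fin 2 → K), IsSelfDualLattice σ ((StdForm.antidiagonal 2).over K) M →
    ∃ u : unitaryGroupOfForm σ ((StdForm.antidiagonal 2).over K), latt (((u : GL (Fin 2) K)) : Matrix (Fin 2) (Fin 2) K) = M)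
  [IsHeckeTriple (⊤ : Submonoid (unitaryGroupOfForm σ ((StdForm.antidiagonal 2).over K)))
    (HermitianLattice.unitaryInt σ ((StdForm.antidiagonal 2).over K)) (HermitianLattice.unitaryInt σ ((StdForm.antidiagonal 2).over K))]
  [LocallyCompactSpace (unitaryGroupOfForm σ ((StdForm.antidiagonal 2).over K))]
  [SecondCountableTopology (unitaryGroupOfForm σ ((StdForm.antidiagonal 2).over K))]
  [MeasurableSpace (unitaryGroupOfForm σ ((StdForm.antidiagonal 2).over K))] [BorelSpace (unitaryGroupOfForm σ ((StdForm.antidiagonal 2).over K))]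
  (γ : unitaryGroupOfForm σ ((StdForm.antidiagonal 2).over K))
  [MeasurableSpace (unitaryGroupOfForm σ ((StdForm.antidiagonal 2).over K) ⧸
    Subgroup.centralizer ({γ} : Set (unitaryGroupOfForm σ ((StdForm.antidiagonal 2).over K))))]
  [BorelSpace (unitaryGroupOfForm σ ((StdForm.antidiagonal 2).over K) ⧸
    Subgroup.centralizer ({γ} : Set (unitaryGroupOfForm σ ((StdForm.antidiagonal 2).over K))))]
  [hC : IsClosed ((Subgroup.centralizer ({γ} : Set (unitaryGroupOfForm σ ((StdForm.antidiagonal 2).over K))) :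
    Subgroup (unitaryGroupOfForm σ ((StdForm.antidiagonal 2).over K))) : Set (unitaryGroupOfForm σ ((StdForm.antidiagonal 2).over K)))]
  (ρ : Measure (Subgroup.centralizer ({γ} : Set (unitaryGroupOfForm σ ((StdForm.antidiagonal 2).over K)))))
  [ρ.IsMulLeftInvariant] [IsFiniteMeasureOnCompacts ρ] [ρ.IsOpenPosMeasure] [ρ.IsInvInvariant] [SFinite ρ]
  (ν : Measure (unitaryGroupOfForm σ ((StdForm.antidiagonal 2).over K))) [IsHaarMeasure ν] [ν.IsMulRightInvariant]
  [CompactSpace (Subgroup.centralizer ({γ} : Set (unitaryGroupOfForm σ ((StdForm.antidiagonal 2).over K))))]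
  (hρ : ρ Set.univ = 1)
include ht hA hρ

/-- **`U(1,1)` — THE ORBITAL INTEGRAL OF THE FUNCTION OF `T = Σ_{k ≤ m} c_k φ′_k` IS `ν(K₀) · Σ_k c_k · #{x self-dual : d(x, γ·x) = 2k}`** (`φ′_k = T_{K₀ t′ᵏ K₀}`, `t′ = diag(ϖ, ϖ⁻¹)`
p03's binder; `γ` with COMPACT centraliser, mass-one `ρ`; `ν` Haar with `ν(K₀) < ∞`; finitely many self-dual vertices displaced by each `2k`, `k ≤ m`): §1's junction summand by
summand over ★ A1-H `orbitalIntegral_doubleCosetShell_eq_mul_ncard_displaced_two` (and its finiteness transfer ★ `finite_quotient_shell_of_finite_displaced_two`).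
[cite: Rogawski1990, §4.9 pp. 54–55] [cite: LabesseLanglands1979, §§2–3] -/
theorem orbitalIntegral_coeff_toVector_eq_mul_sum_ncard_displaced_two (hνK : ν (HermitianLattice.unitaryInt σ ((StdForm.antidiagonal 2).over K)) ≠ ∞)
    (m : ℕ) (c : ℕ → ℂ)
    (T : heckeAlgebra ℂ (unitaryGroupOfForm σ ((StdForm.antidiagonal 2).over K)) (HermitianLattice.unitaryInt σ ((StdForm.antidiagonal 2).over K)))
    (hT : T = ∑ k ∈ Finset.range (m + 1), c k • doubleCosetOperator (HermitianLattice.unitaryInt σ ((StdForm.antidiagonal 2).over K)) (t ^ k))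
    (hfin : ∀ k ≤ m, {x : {M : Submodule 𝒪[K] (Fin 2 → K) // IsSpecialLattice σ ϖ ((StdForm.antidiagonal 2).over K) M} |
        IsSelfDualLattice σ ((StdForm.antidiagonal 2).over K) x.1 ∧
          (latticeTree σ ϖ ((StdForm.antidiagonal 2).over K)).dist x (latticeTreeIso σ ϖ ((StdForm.antidiagonal 2).over K) γ x) = 2 * k}.Finite) :
    orbitalIntegral γ (fun x : unitaryGroupOfForm σ ((StdForm.antidiagonal 2).over K) =>
        (toVector (HermitianLattice.unitaryInt σ ((StdForm.antidiagonal 2).over K)) T).coeff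
          (x : unitaryGroupOfForm σ ((StdForm.antidiagonal 2).over K) ⧸ HermitianLattice.unitaryInt σ ((StdForm.antidiagonal 2).over K)))
        (quotientMeasure (Subgroup.centralizer ({γ} : Set (unitaryGroupOfForm σ ((StdForm.antidiagonal 2).over K)))) ρ hC ν) =
      (ν (HermitianLattice.unitaryInt σ ((StdForm.antidiagonal 2).over K))).toReal *
        ∑ k ∈ Finset.range (m + 1), c k *
          ({x : {M : Submodule 𝒪[K] (Fin 2 → K) // IsSpecialLattice σ ϖ ((StdForm.antidiagonal 2).over K) M} |
              IsSelfDualLattice σ ((StdForm.antidiagonal 2).over K) x.1 ∧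
                (latticeTree σ ϖ ((StdForm.antidiagonal 2).over K)).dist x
                  (latticeTreeIso σ ϖ ((StdForm.antidiagonal 2).over K) γ x) = 2 * k}.ncard : ℂ) := by
  have hK₀ : IsOpen (HermitianLattice.unitaryInt σ ((StdForm.antidiagonal 2).over K) : Set (unitaryGroupOfForm σ ((StdForm.antidiagonal 2).over K))) :=
    HermitianLattice.isOpen_unitaryInt σ _
  -- the function of `T` is `Σ_k c_k 1_{K₀ t^k K₀}`
  have hfun : (fun x : unitaryGroupOfForm σ ((StdForm.antidiagonal 2).over K) =>
      (toVector (HermitianLattice.unitaryInt σ ((StdForm.antidiagonal 2).over K)) T).coeff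
        (x : unitaryGroupOfForm σ ((StdForm.antidiagonal 2).over K) ⧸ HermitianLattice.unitaryInt σ ((StdForm.antidiagonal 2).over K))) =
      ∑ k ∈ Finset.range (m + 1), c k • (DoubleCoset.doubleCoset (t ^ k)
        (HermitianLattice.unitaryInt σ ((StdForm.antidiagonal 2).over K) : Set (unitaryGroupOfForm σ ((StdForm.antidiagonal 2).over K)))
        (HermitianLattice.unitaryInt σ ((StdForm.antidiagonal 2).over K))).indicator (1 : unitaryGroupOfForm σ ((StdForm.antidiagonal 2).over K) → ℂ) := by
    funext x
    rw [hT, coeff_toVector_sum_smul, Finset.sum_apply]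
    refine Finset.sum_congr rfl fun i _ => ?_
    rw [Pi.smul_apply, smul_eq_mul, coeff_toVector_doubleCosetOperator_eq_indicator]
  -- each shell indicator is integrable (finite shell by ★ A1-H's transfer)
  have hint : ∀ k ∈ Finset.range (m + 1), Integrable (descConj γ (Subgroup.centralizer ({γ} : Set (unitaryGroupOfForm σ ((StdForm.antidiagonal 2).over K))))
      (fun _ hg => Subgroup.mem_centralizer_singleton_iff.1 hg)
      ((DoubleCoset.doubleCoset (t ^ k)
        (HermitianLattice.unitaryInt σ ((StdForm.antidiagonal 2).over K) : Set (unitaryGroupOfForm σ ((StdForm.antidiagonal 2).over K)))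
        (HermitianLattice.unitaryInt σ ((StdForm.antidiagonal 2).over K))).indicator (1 : unitaryGroupOfForm σ ((StdForm.antidiagonal 2).over K) → ℂ)))
      (quotientMeasure (Subgroup.centralizer ({γ} : Set (unitaryGroupOfForm σ ((StdForm.antidiagonal 2).over K)))) ρ hC ν) := by
    intro k hk
    refine integrable_descConj_indicator_shell γ (HermitianLattice.unitaryInt σ ((StdForm.antidiagonal 2).over K)) ρ ν
      (isOpen_doubleCoset _ (t ^ k) hK₀) (conj_mem_doubleCoset_iff _ (t ^ k)) hK₀ hρ hνK ?_
    rw [setOf_out_conj_mem_doubleCoset_eq]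
    exact finite_quotient_shell_of_finite_displaced_two hd t ht γ k (hfin k (Nat.lt_succ_iff.mp (Finset.mem_range.mp hk)))
  rw [hfun, orbitalIntegral_finset_sum_smul γ _ _ c _ hint, Finset.mul_sum]
  refine Finset.sum_congr rfl fun k hk => ?_
  rw [orbitalIntegral_indicator_complex_eq_ofReal,
    orbitalIntegral_doubleCosetShell_eq_mul_ncard_displaced_two hd t ht hA γ ρ ν hρ k (hfin k (Nat.lt_succ_iff.mp (Finset.mem_range.mp hk)))]
  push_cast
  ring

end Two

/-! ## §3 The H-side elliptic value of `ξ̂_H(φ_m)` at an inert unramified place -/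

section Adic

open NumberField IsDedekindDomain Literature.NumberTheory.Automorphic.UnitaryGroup
  Literature.NumberTheory.Automorphic.HermitianLattice Literature.NumberTheory.Automorphic.CartanUnique
open Summit.HodgeConjecture.HodgeConjecture.Cruxes.HLiu418.K2LiuRankOneHeckeCellsTwo (rev_vecOne)

variable {F E : Type} [Field F] [NumberField F] [Field E] [NumberField E] [Algebra F E] [Algebra.IsQuadraticExtension F E]
  (c : E ≃ₐ[F] E) (hc1 : c ≠ 1) (v : HeightOneSpectrum (𝓞 F)) (w : PlacesOver E v) (hw : c • w.1 = w.1)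
  (hv : Algebra.IsUnramifiedIn (𝓞 E) v.asIdeal)
  (hA : ∀ M : Submodule 𝒪[w.1.adicCompletion E] (Fin 2 → w.1.adicCompletion E),
    IsSelfDualLattice (galAdicCompletionMap (L := E) c hw) ((StdForm.antidiagonal 2).over (w.1.adicCompletion E)) M →
      ∃ u : unitaryGroupOfForm (galAdicCompletionMap (L := E) c hw) ((StdForm.antidiagonal 2).over (w.1.adicCompletion E)),
        latt (((u : GL (Fin 2) (w.1.adicCompletion E))) : Matrix (Fin 2) (Fin 2) (w.1.adicCompletion E)) = M)
  [LocallyCompactSpace (unitaryGroupOfForm (galAdicCompletionMap (L := E) c hw) ((StdForm.antidiagonal 2).over (w.1.adicCompletion E)))]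
  [SecondCountableTopology (unitaryGroupOfForm (galAdicCompletionMap (L := E) c hw) ((StdForm.antidiagonal 2).over (w.1.adicCompletion E)))]
  [MeasurableSpace (unitaryGroupOfForm (galAdicCompletionMap (L := E) c hw) ((StdForm.antidiagonal 2).over (w.1.adicCompletion E)))]
  [BorelSpace (unitaryGroupOfForm (galAdicCompletionMap (L := E) c hw) ((StdForm.antidiagonal 2).over (w.1.adicCompletion E)))]
  (γ : unitaryGroupOfForm (galAdicCompletionMap (L := E) c hw) ((StdForm.antidiagonal 2).over (w.1.adicCompletion E)))
  [MeasurableSpace (unitaryGroupOfForm (galAdicCompletionMap (L := E) c hw) ((StdForm.antidiagonal 2).over (w.1.adicCompletion E)) ⧸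
    Subgroup.centralizer ({γ} : Set (unitaryGroupOfForm (galAdicCompletionMap (L := E) c hw) ((StdForm.antidiagonal 2).over (w.1.adicCompletion E)))))]
  [BorelSpace (unitaryGroupOfForm (galAdicCompletionMap (L := E) c hw) ((StdForm.antidiagonal 2).over (w.1.adicCompletion E)) ⧸
    Subgroup.centralizer ({γ} : Set (unitaryGroupOfForm (galAdicCompletionMap (L := E) c hw) ((StdForm.antidiagonal 2).over (w.1.adicCompletion E)))))]
  [hC : IsClosed ((Subgroup.centralizer ({γ} : Set (unitaryGroupOfForm (galAdicCompletionMap (L := E) c hw) ((StdForm.antidiagonal 2).over (w.1.adicCompletion E)))) :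
    Subgroup (unitaryGroupOfForm (galAdicCompletionMap (L := E) c hw) ((StdForm.antidiagonal 2).over (w.1.adicCompletion E)))) :
      Set (unitaryGroupOfForm (galAdicCompletionMap (L := E) c hw) ((StdForm.antidiagonal 2).over (w.1.adicCompletion E))))]
  (ρ : Measure (Subgroup.centralizer ({γ} : Set (unitaryGroupOfForm (galAdicCompletionMap (L := E) c hw) ((StdForm.antidiagonal 2).over (w.1.adicCompletion E))))))
  [ρ.IsMulLeftInvariant] [IsFiniteMeasureOnCompacts ρ] [ρ.IsOpenPosMeasure] [ρ.IsInvInvariant] [SFinite ρ]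
  (ν : Measure (unitaryGroupOfForm (galAdicCompletionMap (L := E) c hw) ((StdForm.antidiagonal 2).over (w.1.adicCompletion E))))
  [IsHaarMeasure ν] [ν.IsMulRightInvariant]
  [CompactSpace (Subgroup.centralizer ({γ} : Set (unitaryGroupOfForm (galAdicCompletionMap (L := E) c hw) ((StdForm.antidiagonal 2).over (w.1.adicCompletion E)))))]
  (hρ : ρ Set.univ = 1)
include hA hρ

/-- **CARD H2 — THE H-SIDE ELLIPTIC VALUE OF `ξ̂_H(φ_m)`**: at an inert unramified place `w ∣ v` of `E ∕ F`, for `γ ∈ U(J₀,2)(E_w)` with COMPACT centraliser (Haar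
measure `ρ` of mass one), `ν` a Haar measure on `U(J₀,2)(E_w)` and `m ∈ ℕ`, provided finitely many self-dual vertices of the tree `X₂(E_w)` are displaced by `2k` for each
`k ≤ m`:  `O_γ^{ν∕ρ}(g ↦ (ξ̂_H(φ_m) [K₀])(gK₀)) = ν(K₀) · Σ_{k ≤ m} xiHCoeff q_v m k · #{x ∈ X₂(E_w) : x self-dual ∧ d(x, γ·x) = 2k}`
(`ξ̂_H = satakeGraphPartnerAlgHom`, `φ_m = 1_{K₀ t_wᵐ K₀}`, `q_v = Nat.sqrt #𝓀[E_w]`; `K₀` compact open ★ `isCompact_unitaryInt_adicCompletion`): §2 fed with ★ H1 §3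
`satakeGraphPartnerAlgHom_doubleCosetOperator_torusGen_pow`.  The `U(1)_v`-factor of `H_v` multiplies both sides by `ν₁(U(1)(𝒪_v))` (row E1.3.7.2).
[cite: Rogawski1990, §4.9 Prop. 4.9.1 (b), pp. 54–56] [cite: Rogawski1990, §4.11 pp. 59–60] [cite: LabesseLanglands1979, §§2–3] -/
theorem orbitalIntegral_satakeGraphPartner_torusGen_pow (m : ℕ)
    (hfin : ∀ k ≤ m, {x : {M : Submodule 𝒪[w.1.adicCompletion E] (Fin 2 → w.1.adicCompletion E) //
        IsSpecialLattice (galAdicCompletionMap (L := E) c hw) (localConjUniformizer c hc1 v w hw hv)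
          ((StdForm.antidiagonal 2).over (w.1.adicCompletion E)) M} |
        IsSelfDualLattice (galAdicCompletionMap (L := E) c hw) ((StdForm.antidiagonal 2).over (w.1.adicCompletion E)) x.1 ∧
          (latticeTree (galAdicCompletionMap (L := E) c hw) (localConjUniformizer c hc1 v w hw hv)
              ((StdForm.antidiagonal 2).over (w.1.adicCompletion E))).dist x
            (latticeTreeIso (galAdicCompletionMap (L := E) c hw) (localConjUniformizer c hc1 v w hw hv)
              ((StdForm.antidiagonal 2).over (w.1.adicCompletion E)) γ x) = 2 * k}.Finite) :
    haveI := isHeckeTriple_unitaryInt_adicCompletion c v w hw ((StdForm.antidiagonal 3).over (w.1.adicCompletion E))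
    haveI := isHeckeTriple_unitaryInt_adicCompletion c v w hw ((StdForm.antidiagonal 2).over (w.1.adicCompletion E))
    orbitalIntegral γ
        (fun x : unitaryGroupOfForm (galAdicCompletionMap (L := E) c hw) ((StdForm.antidiagonal 2).over (w.1.adicCompletion E)) =>
          (toVector (unitaryInt (galAdicCompletionMap (L := E) c hw) ((StdForm.antidiagonal 2).over (w.1.adicCompletion E)))
          (satakeGraphPartnerAlgHom c hc1 v w hw hv
            (doubleCosetOperator (unitaryInt (galAdicCompletionMap (L := E) c hw) ((StdForm.antidiagonal 3).over (w.1.adicCompletion E)))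
              ((unramifiedLocalConjDatum_localConjUniformizer c hc1 v w hw hv).torusGen ^ m)))).coeff
          (x : unitaryGroupOfForm (galAdicCompletionMap (L := E) c hw) ((StdForm.antidiagonal 2).over (w.1.adicCompletion E)) ⧸
            unitaryInt (galAdicCompletionMap (L := E) c hw) ((StdForm.antidiagonal 2).over (w.1.adicCompletion E))))
        (quotientMeasure (Subgroup.centralizer ({γ} : Set (unitaryGroupOfForm (galAdicCompletionMap (L := E) c hw)
          ((StdForm.antidiagonal 2).over (w.1.adicCompletion E))))) ρ hC ν) =
      (ν (unitaryInt (galAdicCompletionMap (L := E) c hw) ((StdForm.antidiagonal 2).over (w.1.adicCompletion E)))).toReal *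
        ∑ k ∈ Finset.range (m + 1), xiHCoeff (Nat.sqrt (Nat.card (Valued.ResidueField (w.1.adicCompletion E)))) m k *
          ({x : {M : Submodule 𝒪[w.1.adicCompletion E] (Fin 2 → w.1.adicCompletion E) //
              IsSpecialLattice (galAdicCompletionMap (L := E) c hw) (localConjUniformizer c hc1 v w hw hv)
                ((StdForm.antidiagonal 2).over (w.1.adicCompletion E)) M} |
              IsSelfDualLattice (galAdicCompletionMap (L := E) c hw) ((StdForm.antidiagonal 2).over (w.1.adicCompletion E)) x.1 ∧
                (latticeTree (galAdicCompletionMap (L := E) c hw) (localConjUniformizer c hc1 v w hw hv)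
                    ((StdForm.antidiagonal 2).over (w.1.adicCompletion E))).dist x
                  (latticeTreeIso (galAdicCompletionMap (L := E) c hw) (localConjUniformizer c hc1 v w hw hv)
                    ((StdForm.antidiagonal 2).over (w.1.adicCompletion E)) γ x) = 2 * k}.ncard : ℂ) := by
  haveI := isHeckeTriple_unitaryInt_adicCompletion c v w hw ((StdForm.antidiagonal 3).over (w.1.adicCompletion E))
  haveI := isHeckeTriple_unitaryInt_adicCompletion c v w hw ((StdForm.antidiagonal 2).over (w.1.adicCompletion E))
  have hνK : ν (unitaryInt (galAdicCompletionMap (L := E) c hw) ((StdForm.antidiagonal 2).over (w.1.adicCompletion E))) ≠ ∞ :=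
    (isCompact_unitaryInt_adicCompletion c v w hw ((StdForm.antidiagonal 2).over (w.1.adicCompletion E))).measure_lt_top.ne
  exact orbitalIntegral_coeff_toVector_eq_mul_sum_ncard_displaced_two (unramifiedLocalConjDatum_localConjUniformizer c hc1 v w hw hv)
    (⟨zpowDiagGL (uniformizer_ne_zero (unramifiedLocalConjDatum_localConjUniformizer c hc1 v w hw hv).vϖ) ![(1 : ℤ), -1],
      zpowDiagGL_mem_unitaryGroupOfForm (unramifiedLocalConjDatum_localConjUniformizer c hc1 v w hw hv).σϖ _ rev_vecOne⟩ :
      ↥(unitaryGroupOfForm (galAdicCompletionMap (L := E) c hw) ((StdForm.antidiagonal 2).over (w.1.adicCompletion E))))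
    rfl hA γ ρ ν hρ hνK m (xiHCoeff (Nat.sqrt (Nat.card (Valued.ResidueField (w.1.adicCompletion E)))) m) _
    (satakeGraphPartnerAlgHom_doubleCosetOperator_torusGen_pow c hc1 v w hw hv m) hfin

end Adic

end Summit.HodgeConjecture.HodgeConjecture.R90.S6

end
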